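import Mathlib

/-!
# The `GL(2) × GL(2)` positivity barrier for the crux `DefiniteXi.PeterssonLowerBound` (stmt-ABC-10870)
# (negative-side support, line lead c6; theorems only)

The crux (`c(ε)·N^{1-ε} ≤ Re (f,f)_{Γ₀(N)}` for the newform of every elliptic curve over `ℚ`) is
proved in the tree modulo ONE named fact, the analytic package of `L(s, Sym⁴ E)`
(`Summit.ABC.ABC.Theorems.PeterssonLowerBound_of`, p107692). Leads c1–c6 of the crux line checked
that no argument using only `GL(1)`, `GL(2)` and `GL(2) × GL(2)` `L`-functions can replace that
fact. The combinatorial core of that check is recorded here as elementary, kernel-checked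
inequalities, so that planners and ideators can cite it instead of re-deriving it.

**Dictionary.** Every zero-repulsion argument for `L(s, Sym² f)` (Goldfeld–Hoffstein–Lieman,
Landau–Page, Siegel's product-residue lemma, Deuring–Heilbronn) runs on an auxiliary Euler product
`Z(s) = ∏ L(s, Symⁱ f × Symʲ g)^{m_{ij}}` whose logarithm has non-negative Dirichlet coefficients.
At a prime `p ∤ N_f N_g` and `k ≥ 1` the coefficient of `p^{-ks}/k` in `log Z` is
`c(u, v) = Σ m_{ij} U_i(u) U_j(v)` with `u = 2 cos kθ_p`, `v = 2 cos kφ_p` (Hasse/Deligne make the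
angles real) and `U₀ = 1`, `U₁(x) = x`, `U₂(x) = x² − 1` the characters of `SU(2)`; `m₀₀` is the
order of the pole of `Z` at `s = 1`, `m₂₀` the multiplicity of `L(s, Sym² f)`, `m₁₁` that of the
Rankin–Selberg convolution `L(s, f × g)`. The factors with a classical (`Γ₀(N)`-Rankin–Selberg /
Hecke) analytic theory are exactly `(i, j) ∈ {(0,0), (1,0), (0,1), (1,1), (2,0), (0,2)}`
(`ζ · L(Sym² f) = L(f × f̄)`), so for such arguments
`c(u,v) = m₀₀ + m₁₀ u + m₀₁ v + m₁₁ uv + m₂₀ (u² − 1) + m₀₂ (v² − 1)` — the expression written out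
in every statement below — and positivity of the prime coefficients forces `c ≥ 0` on `[-2, 2]²`
(the pairs `(u, v)` being dense for a generic pair of forms). The theorems then say:

* `pole_order_ge_symmSq_multiplicity` — `m₂₀ + m₀₂ ≤ m₀₀`: the `Sym²`-zeros never outnumber the pole,
  so GHL-type repulsion (which needs zero order `>` pole order) and a Landau–Page statement for two
  forms are unavailable (`ghl_multiplicities_not_gl2Pair`: the diagonal GHL exponents `(2; 3)` of
  `ζ² L(Sym² f)³ L(Sym⁴ f)` are outside the class);
* `four_mul_abs_rankin_multiplicity_le` — `4|m₁₁| ≤ m₀₀ + 3(m₂₀ + m₀₂)`, hence `|m₁₁| ≤ m₀₀`;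
* `siegel_shape_infeasible` — `m₀₀ = 1 ∧ m₁₁ = 1` (a SIMPLE pole together with the cross term
  `L(f × g)`, the shape Siegel's ineffective argument needs so that the residue is the pure product
  `L(1, Sym² f) L(1, Sym² g) L(1, f × g)`) is impossible for integer multiplicities `m₂₀, m₀₂ ≥ 0`
  (for REAL exponents it is not: `ζ (L(Sym² f) L(Sym² g))^{1/2} L(f × g)`, `(u+v)²/2 ≥ 0` — the
  square root of a genuine `L`-product — so integrality is used);
* `deuringHeilbronn_shape_decouples` — if `L(s, Sym² f)` cancels every pole (`m₂₀ = m₀₀`, the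
  shape of a Deuring–Heilbronn argument driven by an exceptional zero of `L(s, Sym² f)`) then
  `m₀₂ = m₀₁ = m₁₀ = m₁₁ = 0`: the auxiliary form `g` drops out entirely;
* `symmSq_pair_rankin_logCoeff_nonneg` — the one positive series outside the `L(Π × Π̃)` class,
  `ζ² L(Sym² f) L(Sym² g) L(f × g)` (`2 + (u²−1) + (v²−1) + uv = u² + uv + v² ≥ 0`), which realises
  the extremal `m₁₁ = 1 < 2 = m₀₀` but, having a double pole, only feeds the derivative-carrying
  form of Siegel's lemma (lead c6, `Cruxes/PeterssonLowerBound/PICKED.md`).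

Hence any repulsion proof of the crux must use a factor `L(s, Symⁱ f × Symʲ g)` with `i` or
`j ≥ 2` other than `(2,0), (0,2)` — `Sym² f × g` (`GL₃ × GL₂`), `Sym² f × Sym² g` (`GL₃ × GL₃`,
Hoffstein–Lockhart 1994, Thm. 0.1) or `Sym⁴ f` (Kim 2003) — i.e. a functoriality input of the size of
the named fact the line already isolates. This file makes no claim about the crux itself (which is a
theorem in print); it is filed `--supports stmt-ABC-10870` as negative-side evidence (theorems only,
no definitions). [cite: HoffsteinLockhart1994, Thm. 0.1 and Appendix]
[cite: IwaniecKowalski2004, Thm. 5.44]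
-/

set_option linter.dupNamespace false

namespace Summit.ABC.ABC.Theorems.PeterssonLowerBound.Negative

variable {m₀₀ m₁₀ m₀₁ m₁₁ m₂₀ m₀₂ : ℤ}

/-- Membership in the Sato–Tate interval `[-2, 2]` from the two inequalities. [folklore] -/
theorem mem_sq {x : ℝ} (h₁ : -2 ≤ x) (h₂ : x ≤ 2) : x ∈ Set.Icc (-2 : ℝ) 2 := ⟨h₁, h₂⟩

/-- **The `Sym²`-zeros never outnumber the pole**: if the `GL(2) × GL(2)` log-coefficient
`m₀₀ + m₁₀u + m₀₁v + m₁₁uv + m₂₀(u²−1) + m₀₂(v²−1)` is non-negative on `[-2,2]²` then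
`m₂₀ + m₀₂ ≤ m₀₀` (evaluate at `u = v = 0`). Consequently no Goldfeld–Hoffstein–Lieman repulsion
(zero order `>` pole order) and no Landau–Page statement for two forms is available with
`GL(2) × GL(2)` data. [folklore] -/
theorem pole_order_ge_symmSq_multiplicity
    (h : ∀ u ∈ Set.Icc (-2 : ℝ) 2, ∀ v ∈ Set.Icc (-2 : ℝ) 2,
      0 ≤ (m₀₀ : ℝ) + m₁₀ * u + m₀₁ * v + m₁₁ * (u * v) + m₂₀ * (u ^ 2 - 1) + m₀₂ * (v ^ 2 - 1)) :
    m₂₀ + m₀₂ ≤ m₀₀ := by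
  have h0 := h 0 (mem_sq (by norm_num) (by norm_num)) 0 (mem_sq (by norm_num) (by norm_num))
  have : ((m₂₀ + m₀₂ : ℤ) : ℝ) ≤ (m₀₀ : ℝ) := by push_cast; linarith
  exact_mod_cast this

/-- **The Rankin–Selberg multiplicity is dominated**: under the same positivity,
`4|m₁₁| ≤ m₀₀ + 3(m₂₀ + m₀₂)` (evaluate at `(2,-2), (-2,2)`, resp. `(2,2), (-2,-2)`).
[folklore] -/
theorem four_mul_abs_rankin_multiplicity_le
    (h : ∀ u ∈ Set.Icc (-2 : ℝ) 2, ∀ v ∈ Set.Icc (-2 : ℝ) 2,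
      0 ≤ (m₀₀ : ℝ) + m₁₀ * u + m₀₁ * v + m₁₁ * (u * v) + m₂₀ * (u ^ 2 - 1) + m₀₂ * (v ^ 2 - 1)) :
    4 * |m₁₁| ≤ m₀₀ + 3 * (m₂₀ + m₀₂) := by
  have h1 := h 2 (mem_sq (by norm_num) (by norm_num)) (-2) (mem_sq (by norm_num) (by norm_num))
  have h2 := h (-2) (mem_sq (by norm_num) (by norm_num)) 2 (mem_sq (by norm_num) (by norm_num))
  have h3 := h 2 (mem_sq (by norm_num) (by norm_num)) 2 (mem_sq (by norm_num) (by norm_num))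
  have h4 := h (-2) (mem_sq (by norm_num) (by norm_num)) (-2) (mem_sq (by norm_num) (by norm_num))
  have hA : ((4 * m₁₁ : ℤ) : ℝ) ≤ ((m₀₀ + 3 * (m₂₀ + m₀₂) : ℤ) : ℝ) := by push_cast; linarith
  have hB : ((-(4 * m₁₁) : ℤ) : ℝ) ≤ ((m₀₀ + 3 * (m₂₀ + m₀₂) : ℤ) : ℝ) := by push_cast; linarith
  have hA' : 4 * m₁₁ ≤ m₀₀ + 3 * (m₂₀ + m₀₂) := by exact_mod_cast hA
  have hB' : -(4 * m₁₁) ≤ m₀₀ + 3 * (m₂₀ + m₀₂) := by exact_mod_cast hB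
  rcases abs_cases m₁₁ with ⟨habs, _⟩ | ⟨habs, _⟩ <;> rw [habs] <;> linarith

/-- Corollary: `|m₁₁| ≤ m₀₀` — the convolution `L(f × g)` never occurs more often than the pole.
[folklore] -/
theorem abs_rankin_multiplicity_le_pole_order
    (h : ∀ u ∈ Set.Icc (-2 : ℝ) 2, ∀ v ∈ Set.Icc (-2 : ℝ) 2,
      0 ≤ (m₀₀ : ℝ) + m₁₀ * u + m₀₁ * v + m₁₁ * (u * v) + m₂₀ * (u ^ 2 - 1) + m₀₂ * (v ^ 2 - 1)) :
    |m₁₁| ≤ m₀₀ := by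
  have h1 := pole_order_ge_symmSq_multiplicity h
  have h2 := four_mul_abs_rankin_multiplicity_le h
  linarith

/-- **Siegel's shape is infeasible**: a simple pole (`m₀₀ = 1`) together with the cross term
`L(f × g)` to the first power (`m₁₁ = 1`) and non-negative integer `Sym²`-multiplicities is
impossible — so Siegel's product-residue argument (which needs the residue at a simple pole to be
the pure product `L(1, Sym² f) L(1, Sym² g) L(1, f × g)`) has no `GL(2) × GL(2)` carrier.
(`m₂₀ + m₀₂ = 1`; then `u = ±2, v = 0` resp. `u = 0, v = ±2` kill the linear term and
`(2,-1), (-2,1)` resp. `(-1,2), (1,-2)` contradict.) [folklore] -/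
theorem siegel_shape_infeasible
    (h : ∀ u ∈ Set.Icc (-2 : ℝ) 2, ∀ v ∈ Set.Icc (-2 : ℝ) 2,
      0 ≤ (m₀₀ : ℝ) + m₁₀ * u + m₀₁ * v + m₁₁ * (u * v) + m₂₀ * (u ^ 2 - 1) + m₀₂ * (v ^ 2 - 1))
    (h00 : m₀₀ = 1) (h11 : m₁₁ = 1) (h20 : 0 ≤ m₂₀) (h02 : 0 ≤ m₀₂) : False := by
  have hsum := pole_order_ge_symmSq_multiplicity h
  have hfour := four_mul_abs_rankin_multiplicity_le h
  rw [h11, abs_one] at hfour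
  have hv1 := h 0 (mem_sq (by norm_num) (by norm_num)) 2 (mem_sq (by norm_num) (by norm_num))
  have hv2 := h 0 (mem_sq (by norm_num) (by norm_num)) (-2) (mem_sq (by norm_num) (by norm_num))
  have hu1 := h 2 (mem_sq (by norm_num) (by norm_num)) 0 (mem_sq (by norm_num) (by norm_num))
  have hu2 := h (-2) (mem_sq (by norm_num) (by norm_num)) 0 (mem_sq (by norm_num) (by norm_num))
  have ha := h (-1) (mem_sq (by norm_num) (by norm_num)) 2 (mem_sq (by norm_num) (by norm_num))
  have hb := h 1 (mem_sq (by norm_num) (by norm_num)) (-2) (mem_sq (by norm_num) (by norm_num))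
  have hc := h 2 (mem_sq (by norm_num) (by norm_num)) (-1) (mem_sq (by norm_num) (by norm_num))
  have hd := h (-2) (mem_sq (by norm_num) (by norm_num)) 1 (mem_sq (by norm_num) (by norm_num))
  have e00 : (m₀₀ : ℝ) = 1 := by exact_mod_cast h00
  have e11 : (m₁₁ : ℝ) = 1 := by exact_mod_cast h11
  rw [e00, e11] at hv1 hv2 hu1 hu2 ha hb hc hd
  rcases Int.le_iff_eq_or_lt.mp h20 with h20' | h20'
  · -- `m₂₀ = 0`, `m₀₂ = 1`
    have h02' : m₀₂ = 1 := by omega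
    have e1 : (m₂₀ : ℝ) = 0 := by exact_mod_cast h20'.symm
    have e2 : (m₀₂ : ℝ) = 1 := by exact_mod_cast h02'
    rw [e1, e2] at hu1 hu2 hc hd
    nlinarith
  · -- `m₂₀ = 1`, `m₀₂ = 0`
    have h20'' : m₂₀ = 1 := by omega
    have h02' : m₀₂ = 0 := by omega
    have e1 : (m₂₀ : ℝ) = 1 := by exact_mod_cast h20''
    have e2 : (m₀₂ : ℝ) = 0 := by exact_mod_cast h02'
    rw [e1, e2] at hv1 hv2 ha hb
    nlinarith

/-- A real quadratic `M u² + L u` that is non-negative for all `u ∈ [-2, 2]` has `L = 0`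
(test `u = -tL`, `t = 1/(|M| + |L| + 1)`). [folklore] -/
theorem linear_coeff_eq_zero_of_nonneg_on_square {M L : ℝ}
    (h : ∀ u ∈ Set.Icc (-2 : ℝ) 2, 0 ≤ M * u ^ 2 + L * u) : L = 0 := by
  by_contra hL
  set t : ℝ := 1 / (|M| + |L| + 1) with ht
  have hden : 0 < |M| + |L| + 1 := by positivity
  have ht0 : 0 < t := by rw [ht]; positivity
  have ht1 : t * (|M| + |L| + 1) = 1 := by
    rw [ht, one_div, inv_mul_cancel₀ hden.ne']
  have htM : M * t < 1 := by
    have h1 : M * t ≤ |M| * t := mul_le_mul_of_nonneg_right (le_abs_self M) ht0.le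
    nlinarith [abs_nonneg L]
  have htL : t * |L| ≤ 2 := by nlinarith [abs_nonneg M, abs_nonneg L]
  have hmem : -(t * L) ∈ Set.Icc (-2 : ℝ) 2 := by
    have : |t * L| ≤ 2 := by rwa [abs_mul, abs_of_pos ht0]
    rw [abs_le] at this
    constructor <;> linarith [this.1, this.2]
  have hval := h _ hmem
  have hL2 : 0 < L ^ 2 := by positivity
  have hrew : M * (-(t * L)) ^ 2 + L * (-(t * L)) = t * L ^ 2 * (M * t - 1) := by ring
  rw [hrew] at hval
  have hpos : 0 < t * L ^ 2 := mul_pos ht0 hL2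
  nlinarith

/-- **The Deuring–Heilbronn shape decouples the auxiliary form**: if `L(s, Sym² f)` cancels every
pole (`m₂₀ = m₀₀`) and `L(s, Sym² g)` does not occur to a negative power, then
`m₀₂ = m₀₁ = m₁₀ = m₁₁ = 0` — nothing of `g` survives, so an exceptional zero of `L(s, Sym² f)`
cannot repel a zero of `L(s, Sym² g)` through a `GL(2) × GL(2)` auxiliary. (`(0,0)` gives
`m₀₂ = 0`; `u = 0, v = ±2` give `m₀₁ = 0`; then `v = ±2` and the previous lemma give
`m₁₀ ± 2 m₁₁ = 0`.) [folklore] -/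
theorem deuringHeilbronn_shape_decouples
    (h : ∀ u ∈ Set.Icc (-2 : ℝ) 2, ∀ v ∈ Set.Icc (-2 : ℝ) 2,
      0 ≤ (m₀₀ : ℝ) + m₁₀ * u + m₀₁ * v + m₁₁ * (u * v) + m₂₀ * (u ^ 2 - 1) + m₀₂ * (v ^ 2 - 1))
    (h20 : m₂₀ = m₀₀) (h02 : 0 ≤ m₀₂) : m₀₂ = 0 ∧ m₀₁ = 0 ∧ m₁₀ = 0 ∧ m₁₁ = 0 := by
  have hsum := pole_order_ge_symmSq_multiplicity h
  have h02' : m₀₂ = 0 := by omega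
  have hv1 := h 0 (mem_sq (by norm_num) (by norm_num)) 2 (mem_sq (by norm_num) (by norm_num))
  have hv2 := h 0 (mem_sq (by norm_num) (by norm_num)) (-2) (mem_sq (by norm_num) (by norm_num))
  have e02 : (m₀₂ : ℝ) = 0 := by exact_mod_cast h02'
  have e20 : (m₂₀ : ℝ) = m₀₀ := by exact_mod_cast h20
  rw [e02, e20] at hv1 hv2
  have h01r : (m₀₁ : ℝ) = 0 := by linarith
  have h01 : m₀₁ = 0 := by exact_mod_cast h01r
  -- along `v = 2` and `v = -2` the coefficient is `m₀₀ u² + (m₁₀ ± 2 m₁₁) u`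
  have hplus : ∀ u ∈ Set.Icc (-2 : ℝ) 2, 0 ≤ (m₀₀ : ℝ) * u ^ 2 + ((m₁₀ : ℝ) + 2 * m₁₁) * u := by
    intro u hu
    have := h u hu 2 (mem_sq (by norm_num) (by norm_num))
    rw [e02, e20, h01r] at this
    nlinarith
  have hminus : ∀ u ∈ Set.Icc (-2 : ℝ) 2, 0 ≤ (m₀₀ : ℝ) * u ^ 2 + ((m₁₀ : ℝ) - 2 * m₁₁) * u := by
    intro u hu
    have := h u hu (-2) (mem_sq (by norm_num) (by norm_num))
    rw [e02, e20, h01r] at this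
    nlinarith
  have e1 := linear_coeff_eq_zero_of_nonneg_on_square hplus
  have e2 := linear_coeff_eq_zero_of_nonneg_on_square hminus
  have h10r : (m₁₀ : ℝ) = 0 := by linarith
  have h11r : (m₁₁ : ℝ) = 0 := by linarith
  exact ⟨h02', h01, by exact_mod_cast h10r, by exact_mod_cast h11r⟩

/-- **The extremal positive series** `ζ² L(Sym² f) L(Sym² g) L(f × g)` (`m₀₀ = 2`,
`m₁₀ = m₀₁ = 0`, `m₁₁ = m₂₀ = m₀₂ = 1`): its good-prime log-coefficient
`2 + (u² − 1) + (v² − 1) + uv = u² + uv + v² = (u + v/2)² + 3v²/4` is non-negative (on all of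
`ℝ²`), realising `m₁₁ = 1` with the minimal pole order `m₀₀ = 2` allowed by
`siegel_shape_infeasible`. [folklore] -/
theorem symmSq_pair_rankin_logCoeff_nonneg (u v : ℝ) :
    0 ≤ ((2 : ℤ) : ℝ) + ((0 : ℤ) : ℝ) * u + ((0 : ℤ) : ℝ) * v + ((1 : ℤ) : ℝ) * (u * v) +
      ((1 : ℤ) : ℝ) * (u ^ 2 - 1) + ((1 : ℤ) : ℝ) * (v ^ 2 - 1) := by
  push_cast
  nlinarith [sq_nonneg (u + v / 2), sq_nonneg v]

/-- The same coefficient in closed form: `2 + (u² − 1) + (v² − 1) + uv = u² + uv + v²`.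
[folklore] -/
theorem symmSq_pair_rankin_logCoeff_eq (u v : ℝ) :
    (2 : ℝ) + 0 * u + 0 * v + 1 * (u * v) + 1 * (u ^ 2 - 1) + 1 * (v ^ 2 - 1) =
      u ^ 2 + u * v + v ^ 2 := by
  ring

/-- **The Goldfeld–Hoffstein–Lieman escape is genuinely outside the class**: the diagonal GHL
auxiliary `ζ² L(Sym² f)³ L(Sym⁴ f)` has `Sym²`-multiplicity `3 > 2 =` pole order, which
`pole_order_ge_symmSq_multiplicity` forbids for every `GL(2) × GL(2)`-constructible positive
series: with `m₀₀ = 2`, `m₂₀ = 3`, `m₀₂ = 0` positivity on `[-2,2]²` fails whatever the remaining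
multiplicities. [folklore] -/
theorem ghl_multiplicities_not_gl2Pair (m₁₀ m₀₁ m₁₁ : ℤ) :
    ¬ ∀ u ∈ Set.Icc (-2 : ℝ) 2, ∀ v ∈ Set.Icc (-2 : ℝ) 2,
      0 ≤ ((2 : ℤ) : ℝ) + m₁₀ * u + m₀₁ * v + m₁₁ * (u * v) + ((3 : ℤ) : ℝ) * (u ^ 2 - 1) +
        ((0 : ℤ) : ℝ) * (v ^ 2 - 1) := by
  intro h
  have := pole_order_ge_symmSq_multiplicity (m₀₀ := 2) (m₂₀ := 3) (m₀₂ := 0) h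
  omega

end Summit.ABC.ABC.Theorems.PeterssonLowerBound.Negative
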